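import Literature.Uncategorized.Crux
import Summits.SmoothPoincare4.SmoothPoincare4.Theses.ZeroSurgeryExotic
import Literature.Topology.FourManifolds.LeeRasmussenParityProofs
import Literature.Topology.FourManifolds.KirbyMovesStrictHandleSlide
import Literature.Topology.FourManifolds.KnotsProofs
import Literature.Topology.FourManifolds.LinkingNumberPushOffInstance
import Literature.Topology.FourManifolds.Rasmussen
import Literature.Topology.FourManifolds.HomotopyBallSliceProofs
import HarnessLib

/-!
# Line `admissible-witness-sieve` for crux `ZeroSurgeryExotic.ZseCruxRasmussen` (stmt-SmoothPoincare4-0366)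

Skeleton of the line of idea card `Ideas/admissible-witness-sieve.md` (crux-ideate r1 k2; triage r1: pass ×3,
merged at lever level with `forced-profile-inversion` — "K′-side homology-cobordism sieve + exhaustive friend
enumeration of the few admissible seeds + ribbon certification; union the seed lists").

## The crux, and where its decl lives

Item 0366 (ledger signature verbatim): `∃ K K' Y s, Y = S³₀(K) ∧ Y = S³₀(K') ∧ K smoothly slice ∧
K'.HasRasmussenInvariant s ∧ s ≠ 0`.  The route decl
`Summit.SmoothPoincare4.SmoothPoincare4.Theses.ZeroSurgeryExotic.ZseCruxRasmussen` is NOT materialised in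
`Theses/ZeroSurgeryExotic.lean` (rev 5 keeps it as a TODO comment, for import-cone reasons); the gate relocated
its verbatim transcription to `Literature.Uncategorized.Crux` (`Literature/Uncategorized/Crux.lean`,
`@[conjecture]`, p72944/p73481), which is what the standing disprover's `Disproof.lean` and the LANDED negative
lemma `Theorems/ZseCruxRasmussen/Negative/Parity.lean` (p74212) talk about.  So that the skeleton audit can see a
theorem concluding the crux BY NAME, this workfile carries a LOCAL MATERIALISATION of the route decl
(`Theses.ZeroSurgeryExotic.ZseCruxRasmussen`, an `abbrev` whose body is the ledger signature verbatim — on the nose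
`Literature.Uncategorized.Crux`, checked by `rfl` below; TO BE DELETED the day the gate writes the decl into the
route file, which this file imports).  The composition `ZseCruxRasmussen_of` concludes that decl; `crux_of_line`
is the same proof read as a proof of the registered conjecture `Literature.Uncategorized.Crux`.

## The line in one paragraph (K′-FIRST CERTIFIED SEARCH)

A witness `(K, K′)` of the crux has two certificates of opposite computational scaling: `s(K′) ≠ 0` needs an honest
Lee/Khovanov computation (dies beyond ~60 crossings; Dunfield–Gong arXiv:2512.21825 p. 37: drilled 0-friends have
median ~154 crossings, "much too large to allow computing Khovanov homology"), whereas "`K` ribbon" is certified by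
a handful of fusion bands on diagrams of hundreds of crossings (DG §2).  Friendship is symmetric, so the expensive
certificate belongs on the SMALL side: fix the SEED `K′` first — a small Gauss diagram `G′` with
`G′.rasmussenInvariant ≠ 0` computed once — then enumerate 0-friends `K` of `K′` (Kegel–Spreer arXiv:2603.22438
Alg. 1 / DG §5.1 drilling, deeper than DG's length-3 pass, plus non-hyperbolic generators) and ribbon-test every
friend found (band search ⇒ a FUSION certificate).  The SIEVE is the seed-selection rule: by Manolescu–Piccirillo
Lemma 3.3 (PROVED in the tree) the seed of any hit is slice in a homotopy 4-ball, hence (Freedman) topologically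
slice, (Ozsváth–Szabó/Hom/HLL) `τ = ε = ν⁺ = 0`, `Υ ≡ 0`, `d`-invariants of prime-power branched covers vanish on
the extending coset — so seeds are taken ONLY from the admissible class
`D = {s_ℚ ≠ 0} ∩ {all homology-cobordism-functorial obstructions vanish}`; class (a) of the card = the partners with
PRINTED `s ≠ 0`: Manolescu–Piccirillo's `K′₁…K′₅` (arXiv:2102.04391 §5.4: `s = −2` over ℚ; `Δ = 1` because
`Δ(Kᵢ) = 1` and the 0-surgery determines the Alexander module, hence topologically slice) and the 25 partners of
Dunfield–Gong Table 10 (p. 45, `s_𝔽₃ = ±2`; one direct `s_ℚ` computation each, triage A3), each to be HFK-screened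
(`τ = ε = ν⁺ = 0`) BEFORE any friend search — the card's cheapest falsifier; class (b) (untwisted Whitehead doubles
with `2τ(J) ≤ 0 < ϑ(J)`) is deferred to line `genus-one-witness-first` (triage r1-1/2/3).  In Lean the line is the
CERTIFICATE PIPELINE by which such a hit lands: `stub_seedFriendHit` (the search: certified seed + Kirby certificate
+ fusion certificate) → `stub_kirbyZeroSurgery` (Kirby's theorem, easy half: a common 0-surgery `Y`) →
`stub_fusionRibbon` (a fusion of a split unlink is ribbon) → the crux, with `s` read off the seed's own diagram
(`Knot.HasRasmussenInvariant` is diagram-based, so this last step is definitional).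

## Typing policy

Everything is stated over existing declarations: `Knot`, `Link`, `Link.IsSplitUnlink`, `Knot.IsBandSum`
(`BandSum.lean`), `Knot.IsRibbon` (Morse-theoretic ribbon discs, `SliceRibbon.lean`), `FramedLink.single`,
`StrictKirbyEquivalent` (`KirbyMovesStrictHandleSlide.lean` — the CORRECTED calculus; the coarser
`KirbyEquivalent.nonempty_diffeomorph` of `KirbyMoves.lean` is refuted/deprecated and is NOT used),
`IsIntegralSurgery`, `Knot.HasGaussDiagram`, `GaussDiagram.rasmussenInvariant` (ℚ-Lee homology; `s₀`, as the crux
demands — triage A3).  The three auxiliary `def`s (`IsFusionStep`, `IsFusionOf`, the only recursion, and nothing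
else) are transparent bookkeeping of "n fusion bands on an (n+1)-component link"; the tree has band sums of two
KNOTS only, so the link-level iteration is spelled out here.  No RBG-link, knot-Floer or triangulation vocabulary
exists in the tree (checked 2026-08-16: `lean search --decl 'RBG|tauInvariant|KnotFloer|HFK|isosig|upsilonInvariant'`
→ only the unrelated `RBGrowth` of kinetic theory), which is why the friend certificate is a Kirby-move certificate (every 0-surgery homeomorphism
is presented by an RBG link, Manolescu–Piccirillo Thm 1.2, whose slam-dunks ARE Kirby moves; DG §5.11 finds such
links for drilled pairs) and why the Floer levels of the sieve stay informal (selection rule, not a stub).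

## Disproof used (`Cruxes/ZseCruxRasmussen/Disproof.lean`, cdisprove cycle 2 v3, 39 kB, read 2026-08-16)

* §1 `cruxWithout{Slice,Nonzero,CommonSurgery,SurgeryK,SurgeryK'}_holds` (every conjunct load-bearing; the tree's
  analogue of `_false_without_`): each conjunct of the crux is delivered by a NAMED piece — `K` slice by
  `stub_fusionRibbon` on the hit's fusion certificate, the common `Y` (both surgery conjuncts at once) by
  `stub_kirbyZeroSurgery` on the hit's Kirby certificate, `s ≠ 0` by the seed's diagram conjunct of
  `stub_seedFriendHit`; nothing is obtained by dropping a conjunct.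
* §2 `crux_false_of_sameKnot/concordant/slicePartner` (mod Rasmussen Thm 1): honoured — `K` and `K′` are separate
  data; `seed_not_isSmoothlySlice` below records that a certified seed is never slice, hence (Fox–Milnor) no
  fusion-certified friend is concordant to it; with `n = 0` bands the "friend" is an unknot and the
  Kirby certificate would force `K′` unknotted (Property R), so a hit has `n ≥ 1` (docstring of the hit).
* §3 `fgmwRasmussenStrategy_of_crux`, `not_crux_of_mmsw911`, `not_crux_of_spc4`: the line is the positive side; a
  hit answers MMSW Q9.11 negatively and refutes SPC4 (`not_smoothPoincare4_of_line`).
* §4 `crux_witness_avoids_gluckTwist`, §7 `exoticCP2Sum_of_crux`: a posteriori properties of a hit's sphere (not a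
  Gluck twist; an exotic `#ℂℙ²`-sum of the sign of `s`) — nothing to pre-empt; the seed classes sit on the `s = −2`
  side (MP) or either sign (DG Table 10).
* §6 parity (LANDED `Negative/Parity.lean`; its proof is repeated in `crux_two_le_abs_of_line`, the module itself not being
  served by the farm at check time): the Kh certificate may stop at `|s| ≥ 2`.
* §8 `witness_profile`, `isTopologicallySlice_partner`, `cruxTopWitness_false_of_freedman` (mod Freedman): THIS IS
  THE SIEVE — the line turns the profile into the seed-selection rule (`seed_isHomotopyBallSlice` proved,
  `seed_isTopologicallySlice` mod the same Freedman hypothesis); no stub uses a topological obstruction as witness.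
* §5 `killSwitch_open` (= 0368, sorried there): the statement a null result of this line's table jobs supports on the
  admissible-seed sector; nothing in the file obstructs the stubs.
Landed Negative modules checked against: `Theorems/ZseCruxRasmussen/Negative/Parity.lean` (read; its two theorems
refute nothing, `crux_two_le_abs_of_line` re-derives its normal form for this line), `Theorems/ZseSVanishesOnPairs/Negative/{LoadBearing,Position,
Strengthenings,Targets}.lean` (sibling crux 0368: they constrain PROOFS of `¬ Crux`; the Conway–Piccirillo pair kills
only the topological / `s(K) = 0` / framing-`m` variants of 0368 — consistent with §8 above).
`ledger negatives --problem SmoothPoincare4`: 0 refuted route statements (route notes, 2026-08-16).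
-/

noncomputable section

-- the prescribed namespace `Summit.<P>.<Sub>.…` duplicates `SmoothPoincare4` (P = Sub)
set_option linter.dupNamespace false

open scoped Manifold ContDiff Topology
open Set Function
open Literature.Topology.FourManifolds Literature.Uncategorized

/-! ### Local materialisation of the crux decl (workfile only; see the module docstring) -/

namespace Summit.SmoothPoincare4.SmoothPoincare4.Theses.ZeroSurgeryExotic

/-- **Route item stmt-SmoothPoincare4-0366 (`zse_crux_rasmussen`, crux #2 of route ZeroSurgeryExotic), ledger
signature VERBATIM** — materialised HERE, in the crux workfile, only because the route file
`Theses/ZeroSurgeryExotic.lean` (rev 5) keeps the item as a TODO comment (it does not import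
`Literature.Topology.FourManifolds.LeeRasmussen`).  It is definitionally the registered open statement
`Literature.Uncategorized.Crux` (next `example`).  DELETE this block as soon as the gate writes the decl into the
route file (this file imports it and would then see a duplicate declaration).
[cite: ManolescuPiccirillo2023, §1 p. 1, Thm. 1.3 and Remark 1.5] -/
abbrev ZseCruxRasmussen : Prop :=
  ∃ (K K' : Literature.Topology.FourManifolds.Knot) (Y : Type) (_ : TopologicalSpace Y) (_ : ChartedSpace (EuclideanSpace ℝ (Fin 3)) Y) (s : ℤ), Literature.Topology.FourManifolds.IsIntegralSurgery (𝓡 3) Y K 0 ∧ Literature.Topology.FourManifolds.IsIntegralSurgery (𝓡 3) Y K' 0 ∧ K.IsSmoothlySlice ∧ K'.HasRasmussenInvariant s ∧ s ≠ 0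

/-- The local materialisation IS the gate's transcription `Literature.Uncategorized.Crux`, on the nose. -/
example : ZseCruxRasmussen = Literature.Uncategorized.Crux := rfl

end Summit.SmoothPoincare4.SmoothPoincare4.Theses.ZeroSurgeryExotic

namespace Summit.SmoothPoincare4.SmoothPoincare4.Cruxes.ZseCruxRasmussen.AdmissibleWitnessSieve

/-- Local notation: `𝔼 n` is `EuclideanSpace ℝ (Fin n)`. -/
local notation "𝔼 " n:arg => EuclideanSpace ℝ (Fin n)

/-! ### Fusion (ribbon) certificates — transparent bookkeeping over `Link` and `Knot.IsBandSum` -/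

/-- **One fusion band.** The `(n+1)`-component link `L'` is obtained from the `(n+2)`-component link `L`
by ONE band: two distinct components `L i`, `L j` are replaced by a band sum of them (`Knot.IsBandSum`,
`BandSum.lean`: an embedded band meeting `L i` in its left edge, `L j` in its right edge) along a band
MISSING every other component, the result being component `0` of `L'`; the other `n` components are
kept, renumbered `1 … n` through the injection `e` (injective with image in the complement of `{i, j}`,
hence onto it by counting).  This is the fusion move of Fox / the "band move" of ribbon certificates
(Dunfield–Gong arXiv:2512.21825 §2).  [cite: GompfStipsicz1999, §6.2] -/
def IsFusionStep {n : ℕ} (L : Link (Fin (n + 1 + 1))) (L' : Link (Fin (n + 1))) : Prop :=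
  ∃ (i j : Fin (n + 1 + 1)) (e : Fin n → Fin (n + 1 + 1)), i ≠ j ∧ Injective e ∧
    (∀ k, e k ≠ i ∧ e k ≠ j) ∧
    Knot.IsBandSum (L.component i) (L.component j) (L'.component 0)
      (⋃ k, range ⇑(L.component (e k))) ∧
    ∀ k : Fin n, L'.component k.succ = L.component (e k)

/-- **`n` fusion bands.** `IsFusionOf n L K`: the knot `K` is obtained from the `(n+1)`-component link `L`
by `n` successive fusion bands (`n = 0`: `K` is the unique component).  Structural recursion on `n`;
transparent.  [cite: GompfStipsicz1999, §6.2] -/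
def IsFusionOf : (n : ℕ) → Link (Fin (n + 1)) → Knot → Prop
  | 0, L, K => L.component 0 = K
  | n + 1, L, K => ∃ L' : Link (Fin (n + 1)), IsFusionStep L L' ∧ IsFusionOf n L' K

/-! ### The stubs -/

/-- **stub 1 (load-bearing, hardest; the search) — an admissible seed with a certified ribbon friend.**
K′-FIRST, in the order the protocol produces the data: a SEED `K'` presented by a Gauss diagram `G'` whose
diagram-level Rasmussen invariant (ℚ-Lee homology of the cube complex of `G'`, `GaussDiagram.rasmussenInvariant`)
is non-zero — computed ONCE on the small diagram (by landed parity, `Negative/Parity.lean`, `≠ 0` may be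
certified as `|s| ≥ 2`); then a FRIEND `K` of `K'` given by a KIRBY CERTIFICATE — the `0`-framed knots
`(K, 0)` and `(K', 0)` are related by strict Kirby moves (isotopy, blow-ups/downs of split `±1`-unknots, strict
handle slides; `StrictKirbyEquivalent`, the corrected calculus of `KirbyMovesStrictHandleSlide.lean`), which is
how an RBG link / slam-dunk sequence for the pair is consumed (Manolescu–Piccirillo Thm 1.2: every 0-surgery
homeomorphism comes from an RBG link; Dunfield–Gong §5.11 finds one for a drilled pair) — and by a FUSION
CERTIFICATE: `K` is `n` fusion bands on an `(n+1)`-component split unlink (the output of a band search).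
Seeds are drawn from the ADMISSIBLE class only (module docstring: MP `K′₁…K′₅`, DG Table-10 partners, after the
HFK screen `τ = ε = ν⁺ = 0`); friends are enumerated per seed (Kegel–Spreer Alg. 1, DG drilling at length > 3,
annulus/RBG generators) and every friend is band-searched.  Why it might fail: the admissible class (a) may be
EMPTY after the HFK screen (DG p. 35: `s = 2τ` for 99.96 % of PS19), and even a non-empty class may have no ribbon
friend (kill switch 0368 / MMSW Q9.11; DG's 78 507 status-matched pairs).  Degenerate data are excluded by the
statement itself: with `n = 0` the friend is an unknot bounding a disc, the Kirby certificate makes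
`S³₀(K') ≅ S¹ × S²`, so `K'` is unknotted (Gabai, Property R) and `s = 0` — a hit has `n ≥ 1`; and `G'` is
realised (`HasGaussDiagram`), so `rasmussenInvariant` takes no junk value (Crux2Probe note, 2026-08-15).
Size: open-problem (a hit disproves SPC4).  [cite: ManolescuPiccirillo2023, Thm. 1.2 and §5.4] -/
theorem stub_seedFriendHit :
    ∃ (K' : Knot) (G' : GaussDiagram) (K : Knot) (n : ℕ) (L : Link (Fin (n + 1))),
      K'.HasGaussDiagram G' ∧ G'.rasmussenInvariant ≠ 0 ∧
      StrictKirbyEquivalent ⟨1, FramedLink.single K 0⟩ ⟨1, FramedLink.single K' 0⟩ ∧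
      L.IsSplitUnlink ∧ IsFusionOf n L K := by
  sorry

/-- **stub 2 — soundness of fusion certificates: a fusion of a split unlink is ribbon** (Fox 1962; "ribbon
knot = fusion of a trivial link"; Gompf–Stipsicz (1999) §6.2, Exercise 6.2.2 direction ⇐).  If the components
of `L` bound pairwise disjoint smoothly embedded discs (`Link.IsSplitUnlink`) and `K` is obtained from `L` by
`n` fusion bands, then `K` bounds a ribbon disc in the tree's Morse-theoretic sense (`Knot.IsRibbon`: a smooth
slice disc whose radial function has only non-degenerate critical points, none a local maximum): push the `n+1`
spanning discs slightly into `B⁴` (one minimum each) and add one saddle per band; by induction on `n` along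
`IsFusionOf`, the inductive step gluing a band rectangle between two already-built discs across the level where
the band sits (the band misses the other components, `IsFusionStep`, and may be assumed transverse to the
spanning discs after a generic choice of the latter — ribbon singularities only).  Why plausibly true: it is the
classical theorem; the work is entirely in the tree's smooth-disc bookkeeping (`IsSliceDisc`, `IsRibbonDisc`,
`BandData`), of the size of `SliceRibbonTransportProofs.lean` / `BandSumConcordance*.lean`.  Size L–XL; absent
from the tree (`IsRibbon` occurs only in `SliceRibbon.lean`, `SliceRibbonTransportProofs.lean`, `SliceKnots.lean`;
no fusion lemma, checked 2026-08-16); needed by EVERY computational witness of this crux, whatever the line.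
[cite: GompfStipsicz1999, §6.2] -/
theorem stub_fusionRibbon :
    ∀ (n : ℕ) (L : Link (Fin (n + 1))) (K : Knot), L.IsSplitUnlink → IsFusionOf n L K → K.IsRibbon := by
  sorry

/-- **stub 3 — soundness of Kirby certificates: strictly Kirby-equivalent `0`-framed knots have a common
`0`-surgery** (Kirby 1978, Thm 1, direction "if": framed links related by blow-ups/downs and handle slides have
orientation-preserving diffeomorphic surgeries; Fenn–Rourke 1979).  In the tree this is the named fact
`StrictKirbyEquivalent.nonempty_diffeomorph` (UNPROVED: its leaf (H) `FramedLink.IsStrictHandleSlide.isSurgery`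
is open, reduced to the slide model (S) `FramedLink.IsStrictHandleSlide.slideModel` by
`isSurgery_of_slideModel`; leaves (E) isotopy, (U) reindexing are discharged) composed with
`exists_isIntegralSurgery_holds` (a `0`-surgery `Y'` of `K'` exists), `FramedLink.isSurgery_single_iff` and
transport of `IsIntegralSurgery` along the diffeomorphism `S³₀(K) ≃ₘ S³₀(K')` (`IsIntegralSurgery.of_diffeomorph`,
whose hypothesis `IsOpenGluing.of_diffeomorph` is a named fact of `ConnectedSum`).  Stated at universe `0` for
`Y`, as the crux is.  Why it might fail: only through the encoding — the NON-strict `KirbyEquivalent` of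
`KirbyMoves.lean` is refuted (bands crossing the push-off collar change the surgery; counterexample in its module
docstring) and is NOT used here; if `IsStrictHandleSlide` needed a further correction the stub would be restated
with it, the line being unaffected.  Size L (= discharging (S)/(H) + blow-down invariance + ten lines of glue).
[cite: Kirby1978, Thm 1] -/
theorem stub_kirbyZeroSurgery :
    ∀ (K K' : Knot),
      StrictKirbyEquivalent ⟨1, FramedLink.single K 0⟩ ⟨1, FramedLink.single K' 0⟩ →
      ∃ (Y : Type) (_ : TopologicalSpace Y) (_ : ChartedSpace (𝔼 3) Y),
        IsIntegralSurgery (𝓡 3) Y K 0 ∧ IsIntegralSurgery (𝓡 3) Y K' 0 := by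
  sorry

/-! ### The composition -/

/-- **The three stubs imply the crux — implication form** (pure logic over the tree; no `sorry`, no stub
constant in the proof term).  From the hit take the seed `(K', G')`, the friend `K` and its two certificates;
Kirby soundness gives a common `0`-surgery `Y`; fusion soundness makes `K` ribbon, hence smoothly slice
(`Knot.IsRibbon.isSmoothlySlice`, proved in the tree); and `K'.HasRasmussenInvariant (G'.rasmussenInvariant)`
holds by definition of the diagram-based predicate (`IsIsotopic.refl`), with `G'.rasmussenInvariant ≠ 0`.
[cite: ManolescuPiccirillo2023, §1 p. 1] -/
theorem crux_of_stubs
    (h₁ : ∃ (K' : Knot) (G' : GaussDiagram) (K : Knot) (n : ℕ) (L : Link (Fin (n + 1))),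
      K'.HasGaussDiagram G' ∧ G'.rasmussenInvariant ≠ 0 ∧
      StrictKirbyEquivalent ⟨1, FramedLink.single K 0⟩ ⟨1, FramedLink.single K' 0⟩ ∧
      L.IsSplitUnlink ∧ IsFusionOf n L K)
    (h₂ : ∀ (n : ℕ) (L : Link (Fin (n + 1))) (K : Knot), L.IsSplitUnlink → IsFusionOf n L K → K.IsRibbon)
    (h₃ : ∀ (K K' : Knot),
      StrictKirbyEquivalent ⟨1, FramedLink.single K 0⟩ ⟨1, FramedLink.single K' 0⟩ →
      ∃ (Y : Type) (_ : TopologicalSpace Y) (_ : ChartedSpace (𝔼 3) Y),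
        IsIntegralSurgery (𝓡 3) Y K 0 ∧ IsIntegralSurgery (𝓡 3) Y K' 0) :
    Crux := by
  obtain ⟨K', G', K, n, L, hG', hs, hKirby, hL, hfus⟩ := h₁
  obtain ⟨Y, _, _, hK, hK'⟩ := h₃ K K' hKirby
  exact ⟨K, K', Y, _, _, G'.rasmussenInvariant, hK, hK', (h₂ n L K hL hfus).isSmoothlySlice,
    ⟨K', G', SphereEmbedding.IsIsotopic.refl K', hG', rfl⟩, hs⟩

/-- **The line closes the crux: the route decl `Theses.ZeroSurgeryExotic.ZseCruxRasmussen` (type literally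
that constant — its local materialisation above, the route file not declaring it yet) from the three registered
stubs, which enter BY NAME.** [cite: ManolescuPiccirillo2023, §1 p. 1] -/
theorem ZseCruxRasmussen_of : Theses.ZeroSurgeryExotic.ZseCruxRasmussen :=
  crux_of_stubs stub_seedFriendHit stub_fusionRibbon stub_kirbyZeroSurgery

/-- The same proof read as a proof of the gate's registered open statement `Literature.Uncategorized.Crux`
(item stmt-SmoothPoincare4-0366 verbatim; definitionally the route decl). [cite: ManolescuPiccirillo2023, §1 p. 1] -/
theorem crux_of_line : Crux :=
  ZseCruxRasmussen_of

/-! ### The sieve (seed-selection rule): the profile of any hit, proved resp. mod the Disproof's hypotheses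

These are Disproof.lean §8 / §2 read as CONSTRAINTS ON THE SEED, i.e. the admissibility class `D` restricted to
what the tree can type (its knot-Floer and `d`-invariant levels are informal: no such objects in the tree). -/

/-- Sieve, level 0 (PROVED; Manolescu–Piccirillo Lemma 3.3 in `IsIntegralSurgery` form, a theorem of the tree):
the seed `K'` of any pair with a ribbon friend is slice in a homotopy 4-ball.  [cite: ManolescuPiccirillo2023, Lemma 3.3] -/
theorem seed_isHomotopyBallSlice {K K' : Knot} {Y : Type} [TopologicalSpace Y] [ChartedSpace (𝔼 3) Y]
    (hK : IsIntegralSurgery (𝓡 3) Y K 0) (hK' : IsIntegralSurgery (𝓡 3) Y K' 0) (hr : K.IsRibbon) :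
    K'.IsHomotopyBallSlice :=
  isHomotopyBallSlice_of_zeroSurgeryPair hK hK' hr.isSmoothlySlice

/-- Sieve, level 1 (mod Freedman, the named hypothesis of Disproof §8 / `Ideator1Sketch`): the seed is
TOPOLOGICALLY slice — so class-(a) seeds must have `Δ = 1` (MP's `K′ᵢ`) or pass the HKL/twisted-Alexander tests
(DG Table-10 partners, whose `K` passed them: the Alexander module is a 0-surgery invariant).
[cite: Freedman1982, Thm. 1.6] -/
theorem seed_isTopologicallySlice (hF : ∀ J : Knot, J.IsHomotopyBallSlice → J.IsTopologicallySlice)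
    {K K' : Knot} {Y : Type} [TopologicalSpace Y] [ChartedSpace (𝔼 3) Y]
    (hK : IsIntegralSurgery (𝓡 3) Y K 0) (hK' : IsIntegralSurgery (𝓡 3) Y K' 0) (hr : K.IsRibbon) :
    K'.IsTopologicallySlice :=
  hF K' (seed_isHomotopyBallSlice hK hK' hr)

/-- Sieve, exclusion side (mod Rasmussen's Theorem 1, the tree's named fact `eq_zero_of_isSmoothlySlice`): a
certified seed is not smoothly slice — so no seed is its own friend, and (Disproof §2) no friend CONCORDANT to the
seed can ever carry a fusion certificate; the enumeration may discard concordance-trivial friends (e.g. the seed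
with a local ribbon knot tied in) outright.  [cite: Rasmussen2010, Thm. 1] -/
theorem seed_not_isSmoothlySlice (hR : eq_zero_of_isSmoothlySlice) {K' : Knot} {G' : GaussDiagram}
    (hG' : K'.HasGaussDiagram G') (hs : G'.rasmussenInvariant ≠ 0) : ¬ K'.IsSmoothlySlice :=
  fun hsl ↦ hs (hR ⟨K', G', SphereEmbedding.IsIsotopic.refl K', hG', rfl⟩ hsl)

/-- Parity normalisation of the Kh certificate (Disproof §6 = LANDED `Negative/Parity.lean`): the line's
conclusion in the `2 ≤ |s|` form — a seed computation may stop as soon as `|s| ≥ 2` is certified.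
[cite: Rasmussen2010, Prop. 3.3] -/
theorem crux_two_le_abs_of_line :
    ∃ (K K' : Knot) (Y : Type) (_ : TopologicalSpace Y) (_ : ChartedSpace (EuclideanSpace ℝ (Fin 3)) Y)
      (s : ℤ), IsIntegralSurgery (𝓡 3) Y K 0 ∧ IsIntegralSurgery (𝓡 3) Y K' 0 ∧ K.IsSmoothlySlice ∧
        K'.HasRasmussenInvariant s ∧ 2 ≤ |s| := by
  -- the proof of the landed `Theorems/ZseCruxRasmussen/Negative/Parity.lean :: crux_iff_two_le_abs` (→),
  -- repeated here because the farm serves Theorems modules of this crux only once built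
  obtain ⟨K, K', Y, _, _, s, hK, hK', hsl, hs, hs0⟩ := ZseCruxRasmussen_of
  refine ⟨K, K', Y, _, _, s, hK, hK', hsl, hs, ?_⟩
  obtain ⟨K'', D, -, hD, rfl⟩ := hs
  obtain ⟨t, ht⟩ := GaussDiagram.even_rasmussenInvariant_holds ⟨K'', hD⟩
  rw [ht] at hs0 ⊢
  have ht0 : t ≠ 0 := by rintro rfl; exact hs0 (by simp)
  rw [← two_mul, abs_mul, abs_two]
  have : 1 ≤ |t| := Int.one_le_abs ht0
  linarith

/-! ### Downstream: what a hit decides (route decls by name) -/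

/-- A hit proves the route's thesis `ZseThesis` (item 0364), mod Rasmussen's Theorem 1. [cite: Rasmussen2010, Thm. 1] -/
theorem zseThesis_of_line (hR : eq_zero_of_isSmoothlySlice) : Theses.ZeroSurgeryExotic.ZseThesis := by
  obtain ⟨K, K', Y, _, _, s, hK, hK', hsl, hs, hs0⟩ := ZseCruxRasmussen_of
  exact ⟨K, K', Y, _, _, hK, hK', hsl, fun hsl' ↦ hs0 (hR hs hsl')⟩

/-- … and hence refutes `SmoothPoincare4` (mod Rasmussen's Theorem 1), through the PROVED Manolescu–Piccirillo
Lemma 3.3 and the PROVED FGMW lemma of the tree.  [cite: FreedmanGompfMorrisonWalker2010, §1] -/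
theorem not_smoothPoincare4_of_line (hR : eq_zero_of_isSmoothlySlice) : ¬ _root_.SmoothPoincare4 := by
  intro hS
  obtain ⟨K, K', Y, _, _, s, hK, hK', hsl, hs, hs0⟩ := ZseCruxRasmussen_of
  have hH : K'.IsHomotopyBallSlice := isHomotopyBallSlice_of_zeroSurgeryPair hK hK' hsl
  have hns : ¬ K'.IsSmoothlySlice := fun hsl' ↦ hs0 (hR hs hsl')
  obtain ⟨M, i₁, i₂, i₃, i₄, i₅, i₆, ⟨e⟩, hE⟩ :=
    Knot.exists_exotic_of_isHomotopyBallSlice_not_isSmoothlySlice_holds ⟨K', hH, hns⟩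
  obtain ⟨d⟩ := hS M i₄ i₅ e
  exact hE.false d

end Summit.SmoothPoincare4.SmoothPoincare4.Cruxes.ZseCruxRasmussen.AdmissibleWitnessSieve

end
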